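import Summits.KontsevichZagierPeriods.KontsevichZagierPeriods.Theorems.HyperbolicBlochFiveTermTransfer
import Literature.Geometry.Riemannian.TwistorFrameChange

/-!
# `OffTetraSectorKernel` (stmt-KontsevichZagierPeriods-10557) — line `odd-hyperbolic-ladder`
(skeleton v3), stub `stub_idealSpxClass`: auxiliary lemmas

Linear algebra of the paraboloid lift `Ql p = (|p|², p₀, p₁, 1)` used by the stub
`stub_idealSpxClass` (file `…StubIdealSpxClass.lean`): the lifted simplex
`Spx v = {p | 0 < p₂ ∧ ∀ a, 0 < det v · det (v with row a := Ql p)}` of four rows is unchanged by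
positive rescaling and by permutation of the rows; null future rows are positive multiples of lifted
ideal points `ℓ'(w) = (|w|², Re w, Im w, 1)` or of `(1, 0, 0, 0)`; the boundary similarity
`z ↦ α z + β`, `t ↦ ‖α‖ t` and the inversion `J p = (p₀, −p₁, p₂)/|p|²` act on lifts through explicit
Lorentz matrices (`simil_Ql`, `inversion_Ql`), so that the covariance statement of the neighbour stub
`stub_spxCovariance` (taken as a hypothesis) computes the images of `Spx v` (`simil_image`,
`inversion_image`); and the two-part goal of the stub (existence of a representation with integrand
`t⁻³`, class of every such representation) travels along a pair of mutually inverse moves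
(`idealSpxAux_goal_transport`, the registered sub-goal of this file). Everything else is elementary (the tree's Laplace expansion `Matrix.det_fin_four`,
`ring`). [folklore]
-/

noncomputable section

open Set
open Literature.NumberTheory.Transcendental
open Summit.KontsevichZagierPeriods.HyperbolicBloch.IsometryMove (inversion_inversion inversion_normSq_pos)

namespace Summit.KontsevichZagierPeriods.HyperbolicBloch.OffTetraSectorKernel

/-! ## Linear algebra of the lift -/

/-- Rows acted on by a matrix `M` with `det M ≠ 0` keep a non-zero determinant (`det (v Mᵀ) = det v · det M`).
[folklore] -/
theorem det_rows_mulVec_ne_zero {M : Matrix (Fin 4) (Fin 4) ℝ} {v : Fin 4 → Fin 4 → ℝ}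
    (hv : (Matrix.of v).det ≠ 0) (hM : M.det ≠ 0) : (Matrix.of fun i => M.mulVec (v i)).det ≠ 0 := by
  have h : (Matrix.of fun i => M.mulVec (v i)) = Matrix.of v * M.transpose := by
    ext i k
    simp only [Matrix.of_apply, Matrix.mulVec, dotProduct, Matrix.mul_apply, Matrix.transpose_apply]
    exact Finset.sum_congr rfl fun j _ => mul_comm _ _
  rw [h, Matrix.det_mul, Matrix.det_transpose]
  exact mul_ne_zero hv hM

/-- Two proportional rows make the determinant vanish. [folklore] -/
theorem det_eq_zero_of_row_smul {v : Fin 4 → Fin 4 → ℝ} {i j : Fin 4} (hij : i ≠ j) {k : ℝ}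
    (h : v j = k • v i) : (Matrix.of v).det = 0 := by
  have e : Matrix.of v = (Matrix.of v).updateRow j (k • v i) := by
    rw [← h]
    exact ((Matrix.of v).updateRow_eq_self j).symm
  rw [e, Matrix.det_updateRow_smul]
  refine mul_eq_zero_of_right _ (Matrix.det_zero_of_row_eq hij ?_)
  ext b
  simp [Matrix.updateRow_apply, hij]

/-- A null future row with positive last entry is a positive multiple of the lift
`ℓ'(u) = (|u|², Re u, Im u, 1)` of the ideal point `u = (r₁ + i r₂)/r₃`. [folklore] -/
theorem row_eq_smul_lift {r : Fin 4 → ℝ} (hnull : r 1 ^ 2 + r 2 ^ 2 = r 0 * r 3) (h3 : 0 < r 3) :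
    r = r 3 • ![Complex.normSq (⟨r 1 / r 3, r 2 / r 3⟩ : ℂ), (⟨r 1 / r 3, r 2 / r 3⟩ : ℂ).re,
      (⟨r 1 / r 3, r 2 / r 3⟩ : ℂ).im, 1] := by
  have h3' : r 3 ≠ 0 := h3.ne'
  ext j
  fin_cases j
  · simp only [Complex.normSq_mk]
    simp
    field_simp
    linear_combination -hnull
  · simp; field_simp
  · simp; field_simp
  · simp

/-- A null future row with vanishing last entry is a positive multiple of the lift `(1, 0, 0, 0)` of
`∞`. [folklore] -/
theorem row_eq_smul_inf {r : Fin 4 → ℝ} (hnull : r 1 ^ 2 + r 2 ^ 2 = r 0 * r 3) (h3 : r 3 = 0) :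
    r = r 0 • ![(1 : ℝ), 0, 0, 0] := by
  have h12 : r 1 ^ 2 + r 2 ^ 2 = 0 := by rw [hnull, h3, mul_zero]
  have h1 : r 1 = 0 := by nlinarith [sq_nonneg (r 1), sq_nonneg (r 2)]
  have h2 : r 2 = 0 := by nlinarith [sq_nonneg (r 1), sq_nonneg (r 2)]
  ext j
  fin_cases j <;> simp [h1, h2, h3]

/-- A complex number with real-algebraic real and imaginary parts is algebraic. [folklore] -/
theorem isAlgebraic_mk {a b : ℝ} (ha : IsAlgebraic ℚ a) (hb : IsAlgebraic ℚ b) :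
    IsAlgebraic ℚ (⟨a, b⟩ : ℂ) := by
  have hI : IsAlgebraic ℚ Complex.I :=
    ⟨Polynomial.X ^ 2 + 1, Polynomial.Monic.ne_zero (by monicity!), by simp⟩
  have ha' : IsAlgebraic ℚ (a : ℂ) :=
    (isAlgebraic_algebraMap_iff (A := ℂ) Complex.ofReal_injective).mpr ha
  have hb' : IsAlgebraic ℚ (b : ℂ) :=
    (isAlgebraic_algebraMap_iff (A := ℂ) Complex.ofReal_injective).mpr hb
  rw [Complex.mk_eq_add_mul_I]
  exact ha'.add (hb'.mul hI)

/-! ## Invariances of the lifted simplex -/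

/-- Scaling the rows by positive factors does not change the lifted simplex. [folklore] -/
theorem spx_smul_eq (Ql : (Fin 3 → ℝ) → Fin 4 → ℝ)
    (Spx : (Fin 4 → Fin 4 → ℝ) → Set (Fin 3 → ℝ))
    (hSpx : ∀ v, Spx v = {p | 0 < p 2 ∧ ∀ a, 0 < (Matrix.of v).det * ((Matrix.of v).updateRow a (Ql p)).det})
    (v : Fin 4 → Fin 4 → ℝ) (c : Fin 4 → ℝ) (hc : ∀ i, 0 < c i) :
    Spx (fun i => c i • v i) = Spx v := by
  have hdet : (Matrix.of fun i => c i • v i).det = (∏ i, c i) * (Matrix.of v).det := by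
    rw [← Matrix.det_mul_column]
    rfl
  have hupd : ∀ (a : Fin 4) (Q : Fin 4 → ℝ), ((Matrix.of fun i => c i • v i).updateRow a Q).det =
      (∏ i, Function.update c a 1 i) * ((Matrix.of v).updateRow a Q).det := by
    intro a Q
    rw [← Matrix.det_mul_column]
    congr 1
    ext i j
    simp only [Matrix.updateRow_apply, Matrix.of_apply, Function.update_apply]
    split_ifs with h
    · ring
    · rfl
  have hpos : 0 < ∏ i, c i := Finset.prod_pos fun i _ => hc i
  have hpos' : ∀ a : Fin 4, 0 < ∏ i, Function.update c a 1 i := fun a =>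
    Finset.prod_pos fun i _ => by
      rcases eq_or_ne i a with rfl | h
      · simp
      · rw [Function.update_of_ne h]; exact hc i
  ext p
  simp only [hSpx, mem_setOf_eq, hdet, hupd]
  refine and_congr Iff.rfl (forall_congr' fun a => ?_)
  rw [show (∏ i, c i) * (Matrix.of v).det * ((∏ i, Function.update c a 1 i) * ((Matrix.of v).updateRow a (Ql p)).det)
      = ((∏ i, c i) * ∏ i, Function.update c a 1 i) *
        ((Matrix.of v).det * ((Matrix.of v).updateRow a (Ql p)).det) by ring]
  exact mul_pos_iff_of_pos_left (mul_pos hpos (hpos' a))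

/-- Permuting the rows does not change the lifted simplex. [folklore] -/
theorem spx_perm_eq (Ql : (Fin 3 → ℝ) → Fin 4 → ℝ)
    (Spx : (Fin 4 → Fin 4 → ℝ) → Set (Fin 3 → ℝ))
    (hSpx : ∀ v, Spx v = {p | 0 < p 2 ∧ ∀ a, 0 < (Matrix.of v).det * ((Matrix.of v).updateRow a (Ql p)).det})
    (v : Fin 4 → Fin 4 → ℝ) (σ : Equiv.Perm (Fin 4)) :
    Spx (fun i => v (σ i)) = Spx v := by
  have hsub : (Matrix.of fun i => v (σ i)) = (Matrix.of v).submatrix σ id := rfl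
  have hdet : (Matrix.of fun i => v (σ i)).det = Equiv.Perm.sign σ * (Matrix.of v).det := by
    rw [hsub, Matrix.det_permute]
  have hupd : ∀ (a : Fin 4) (Q : Fin 4 → ℝ), ((Matrix.of fun i => v (σ i)).updateRow a Q).det =
      Equiv.Perm.sign σ * ((Matrix.of v).updateRow (σ a) Q).det := by
    intro a Q
    rw [← Matrix.det_permute]
    congr 1
    ext i j
    simp only [Matrix.updateRow_apply, Matrix.of_apply, Matrix.submatrix_apply, id,
      Equiv.apply_eq_iff_eq]
  have hs : ((Equiv.Perm.sign σ : ℤ) : ℝ) * ((Equiv.Perm.sign σ : ℤ) : ℝ) = 1 := by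
    rw [← Int.cast_mul, ← Units.val_mul, Int.units_mul_self, Units.val_one, Int.cast_one]
  ext p
  simp only [hSpx, mem_setOf_eq, hdet, hupd]
  refine and_congr Iff.rfl ?_
  rw [← Equiv.forall_congr_right
    (q := fun a => 0 < (Matrix.of v).det * ((Matrix.of v).updateRow a (Ql p)).det) σ]
  refine forall_congr' fun a => ?_
  rw [show (Equiv.Perm.sign σ : ℝ) * (Matrix.of v).det *
      ((Equiv.Perm.sign σ : ℝ) * ((Matrix.of v).updateRow (σ a) (Ql p)).det)
      = ((Equiv.Perm.sign σ : ℝ) * (Equiv.Perm.sign σ : ℝ)) *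
        ((Matrix.of v).det * ((Matrix.of v).updateRow (σ a) (Ql p)).det) by ring,
    hs, one_mul]

/-- The lifted simplex lies in the open upper half space. [folklore] -/
theorem spx_subset (Ql : (Fin 3 → ℝ) → Fin 4 → ℝ)
    (Spx : (Fin 4 → Fin 4 → ℝ) → Set (Fin 3 → ℝ))
    (hSpx : ∀ v, Spx v = {p | 0 < p 2 ∧ ∀ a, 0 < (Matrix.of v).det * ((Matrix.of v).updateRow a (Ql p)).det})
    (v : Fin 4 → Fin 4 → ℝ) : Spx v ⊆ {p | 0 < p 2} := fun p hp => by
  rw [hSpx] at hp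
  exact hp.1

/-! ## Boundary similarities and the inversion in the lift -/

/-- The Lorentz matrix of the boundary similarity `z ↦ α z + β`, `t ↦ ‖α‖ t` in the paraboloid lift:
`Ql (S p) = M_S (Ql p)`. [folklore] -/
theorem simil_Ql (Ql : (Fin 3 → ℝ) → Fin 4 → ℝ) (hQl : ∀ p, Ql p = ![p 0 ^ 2 + p 1 ^ 2 + p 2 ^ 2, p 0, p 1, 1])
    (α β : ℂ) (S : (Fin 3 → ℝ) → (Fin 3 → ℝ))
    (hS : ∀ p, S p = ![(α * (Complex.mk (p 0) (1 * p 1)) + β).re, (α * (Complex.mk (p 0) (1 * p 1)) + β).im,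
      ‖α‖ * p 2]) (M : Matrix (Fin 4) (Fin 4) ℝ)
    (hM : M = !![α.re ^ 2 + α.im ^ 2, 2 * (α.re * β.re + α.im * β.im), 2 * (α.re * β.im - α.im * β.re),
      β.re ^ 2 + β.im ^ 2; 0, α.re, -α.im, β.re; 0, α.im, α.re, β.im; 0, 0, 0, 1]) (p : Fin 3 → ℝ) :
    Ql (S p) = M.mulVec (Ql p) := by
  subst hM
  have hn : ‖α‖ ^ 2 = α.re ^ 2 + α.im ^ 2 := by rw [Complex.sq_norm, Complex.normSq_apply]; ring
  rw [hQl, hQl, hS]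
  ext i
  fin_cases i <;> simp [Matrix.mulVec, dotProduct, Fin.sum_univ_four] <;> nlinarith [hn]

/-- Determinant of the similarity matrix: `|α|⁴`. [folklore] -/
theorem simil_det (α β : ℂ) (M : Matrix (Fin 4) (Fin 4) ℝ)
    (hM : M = !![α.re ^ 2 + α.im ^ 2, 2 * (α.re * β.re + α.im * β.im), 2 * (α.re * β.im - α.im * β.re),
      β.re ^ 2 + β.im ^ 2; 0, α.re, -α.im, β.re; 0, α.im, α.re, β.im; 0, 0, 0, 1]) :
    M.det = (α.re ^ 2 + α.im ^ 2) ^ 2 := by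
  subst hM
  rw [Matrix.det_fin_four]
  simp
  ring

/-- The similarity matrix maps the lift of an ideal point `w` to the lift of `α w + β`. [folklore] -/
theorem simil_mulVec_lift (α β : ℂ) (M : Matrix (Fin 4) (Fin 4) ℝ)
    (hM : M = !![α.re ^ 2 + α.im ^ 2, 2 * (α.re * β.re + α.im * β.im), 2 * (α.re * β.im - α.im * β.re),
      β.re ^ 2 + β.im ^ 2; 0, α.re, -α.im, β.re; 0, α.im, α.re, β.im; 0, 0, 0, 1]) (w : ℂ) :
    M.mulVec ![Complex.normSq w, w.re, w.im, 1] =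
      ![Complex.normSq (α * w + β), (α * w + β).re, (α * w + β).im, 1] := by
  subst hM
  ext i
  fin_cases i <;> simp [Matrix.mulVec, dotProduct, Fin.sum_univ_four, Complex.normSq_apply] <;> ring

/-- The similarity matrix fixes the lift of `∞` up to the factor `|α|²`. [folklore] -/
theorem simil_mulVec_inf (α β : ℂ) (M : Matrix (Fin 4) (Fin 4) ℝ)
    (hM : M = !![α.re ^ 2 + α.im ^ 2, 2 * (α.re * β.re + α.im * β.im), 2 * (α.re * β.im - α.im * β.re),
      β.re ^ 2 + β.im ^ 2; 0, α.re, -α.im, β.re; 0, α.im, α.re, β.im; 0, 0, 0, 1]) :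
    M.mulVec ![1, 0, 0, 0] = (α.re ^ 2 + α.im ^ 2) • ![(1 : ℝ), 0, 0, 0] := by
  subst hM
  ext i
  fin_cases i <;> simp [Matrix.mulVec, dotProduct, Fin.sum_univ_four]

/-- The inverse similarity `S' = S(α⁻¹, -α⁻¹β)`: `S' ∘ S = id` and `S ∘ S' = id`. [folklore] -/
theorem simil_inv_apply {α : ℂ} (β : ℂ) (hα : α ≠ 0) (S S' : (Fin 3 → ℝ) → (Fin 3 → ℝ))
    (hS : ∀ p, S p = ![(α * (Complex.mk (p 0) (1 * p 1)) + β).re, (α * (Complex.mk (p 0) (1 * p 1)) + β).im,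
      ‖α‖ * p 2])
    (hS' : ∀ p, S' p = ![(α⁻¹ * (Complex.mk (p 0) (1 * p 1)) + -(α⁻¹ * β)).re,
      (α⁻¹ * (Complex.mk (p 0) (1 * p 1)) + -(α⁻¹ * β)).im, ‖α⁻¹‖ * p 2]) (p : Fin 3 → ℝ) :
    S' (S p) = p ∧ S (S' p) = p := by
  constructor
  · have hz : (Complex.mk (S p 0) (1 * S p 1) : ℂ) = α * (Complex.mk (p 0) (1 * p 1)) + β :=
      Complex.ext (by simp [hS]) (by simp [hS])
    have h2 : S p 2 = ‖α‖ * p 2 := by simp [hS]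
    rw [hS' (S p), hz, h2]
    have e : α⁻¹ * (α * (Complex.mk (p 0) (1 * p 1)) + β) + -(α⁻¹ * β) = Complex.mk (p 0) (1 * p 1) := by
      rw [mul_add, inv_mul_cancel_left₀ hα]; ring
    rw [e]
    ext i
    fin_cases i
    · simp
    · simp
    · simp [norm_inv, inv_mul_cancel_left₀ (norm_ne_zero_iff.mpr hα)]
  · have hz : (Complex.mk (S' p 0) (1 * S' p 1) : ℂ) = α⁻¹ * (Complex.mk (p 0) (1 * p 1)) + -(α⁻¹ * β) :=
      Complex.ext (by simp [hS']) (by simp [hS'])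
    have h2 : S' p 2 = ‖α⁻¹‖ * p 2 := by simp [hS']
    rw [hS (S' p), hz, h2]
    have e : α * (α⁻¹ * (Complex.mk (p 0) (1 * p 1)) + -(α⁻¹ * β)) + β = Complex.mk (p 0) (1 * p 1) := by
      rw [mul_add, mul_inv_cancel_left₀ hα, mul_neg, mul_inv_cancel_left₀ hα]; ring
    rw [e]
    ext i
    fin_cases i
    · simp
    · simp
    · simp [norm_inv, mul_inv_cancel_left₀ (norm_ne_zero_iff.mpr hα)]

/-- **Covariance for similarities** (from the covariance hypothesis): a boundary similarity maps
`Spx v` onto `Spx (M_S v)`. [folklore] -/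
theorem simil_image (Ql : (Fin 3 → ℝ) → Fin 4 → ℝ) (hQl : ∀ p, Ql p = ![p 0 ^ 2 + p 1 ^ 2 + p 2 ^ 2, p 0, p 1, 1])
    (Spx : (Fin 4 → Fin 4 → ℝ) → Set (Fin 3 → ℝ))
    (hcov : ∀ (g : (Fin 3 → ℝ) → (Fin 3 → ℝ)) (M : Matrix (Fin 4) (Fin 4) ℝ) (c : (Fin 3 → ℝ) → ℝ), M.det ≠ 0 →
      (∀ p : Fin 3 → ℝ, 0 < p 2 → 0 < c p ∧ 0 < g p 2 ∧ Ql (g p) = c p • M.mulVec (Ql p)) →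
      (∀ p' : Fin 3 → ℝ, 0 < p' 2 → ∃ p : Fin 3 → ℝ, 0 < p 2 ∧ g p = p') →
      ∀ v : Fin 4 → Fin 4 → ℝ, g '' Spx v = Spx (fun i => M.mulVec (v i)))
    {α : ℂ} (β : ℂ) (hα : α ≠ 0) (S : (Fin 3 → ℝ) → (Fin 3 → ℝ))
    (hS : ∀ p, S p = ![(α * (Complex.mk (p 0) (1 * p 1)) + β).re, (α * (Complex.mk (p 0) (1 * p 1)) + β).im,
      ‖α‖ * p 2]) (M : Matrix (Fin 4) (Fin 4) ℝ)
    (hM : M = !![α.re ^ 2 + α.im ^ 2, 2 * (α.re * β.re + α.im * β.im), 2 * (α.re * β.im - α.im * β.re),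
      β.re ^ 2 + β.im ^ 2; 0, α.re, -α.im, β.re; 0, α.im, α.re, β.im; 0, 0, 0, 1])
    (v : Fin 4 → Fin 4 → ℝ) : S '' Spx v = Spx (fun i => M.mulVec (v i)) := by
  obtain ⟨S', hS'⟩ : ∃ S' : (Fin 3 → ℝ) → (Fin 3 → ℝ), ∀ p, S' p =
      ![(α⁻¹ * (Complex.mk (p 0) (1 * p 1)) + -(α⁻¹ * β)).re,
        (α⁻¹ * (Complex.mk (p 0) (1 * p 1)) + -(α⁻¹ * β)).im, ‖α⁻¹‖ * p 2] := ⟨_, fun _ => rfl⟩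
  have hN : 0 < α.re ^ 2 + α.im ^ 2 := by
    have h := Complex.normSq_pos.mpr hα
    rw [Complex.normSq_apply] at h
    nlinarith [h]
  refine hcov S M (fun _ => 1) ?_ ?_ ?_ v
  · rw [simil_det α β M hM]
    positivity
  · intro p hp
    refine ⟨one_pos, ?_, ?_⟩
    · simp only [hS, Matrix.cons_val_two, Matrix.tail_cons, Matrix.head_cons]
      exact mul_pos (norm_pos_iff.mpr hα) hp
    · rw [one_smul]
      exact simil_Ql Ql hQl α β S hS M hM p
  · intro p' hp'
    refine ⟨S' p', ?_, (simil_inv_apply β hα S S' hS hS' p').2⟩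
    simp only [hS', Matrix.cons_val_two, Matrix.tail_cons, Matrix.head_cons]
    exact mul_pos (norm_pos_iff.mpr (inv_ne_zero hα)) hp'

/-- The Lorentz matrix of the inversion `J p = (p₀, -p₁, p₂)/|p|²` in the paraboloid lift:
`Ql (J p) = |p|⁻² · M_J (Ql p)`. [folklore] -/
theorem inversion_Ql (Ql : (Fin 3 → ℝ) → Fin 4 → ℝ) (hQl : ∀ p, Ql p = ![p 0 ^ 2 + p 1 ^ 2 + p 2 ^ 2, p 0, p 1, 1])
    (J : (Fin 3 → ℝ) → (Fin 3 → ℝ))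
    (hJ : ∀ p, J p = ![p 0 / (p 0 ^ 2 + p 1 ^ 2 + p 2 ^ 2), -p 1 / (p 0 ^ 2 + p 1 ^ 2 + p 2 ^ 2),
      p 2 / (p 0 ^ 2 + p 1 ^ 2 + p 2 ^ 2)]) {p : Fin 3 → ℝ} (hp : p 0 ^ 2 + p 1 ^ 2 + p 2 ^ 2 ≠ 0) :
    Ql (J p) = (1 / (p 0 ^ 2 + p 1 ^ 2 + p 2 ^ 2)) •
      (!![0, 0, 0, 1; 0, 1, 0, 0; 0, 0, -1, 0; 1, 0, 0, 0] : Matrix (Fin 4) (Fin 4) ℝ).mulVec (Ql p) := by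
  rw [hQl, hQl, hJ]
  ext i
  fin_cases i <;> simp <;> field_simp

/-- **Covariance for the inversion** (from the covariance hypothesis): `J` maps `Spx v` onto
`Spx (M_J v)`. [folklore] -/
theorem inversion_image (Ql : (Fin 3 → ℝ) → Fin 4 → ℝ) (hQl : ∀ p, Ql p = ![p 0 ^ 2 + p 1 ^ 2 + p 2 ^ 2, p 0, p 1, 1])
    (Spx : (Fin 4 → Fin 4 → ℝ) → Set (Fin 3 → ℝ))
    (hcov : ∀ (g : (Fin 3 → ℝ) → (Fin 3 → ℝ)) (M : Matrix (Fin 4) (Fin 4) ℝ) (c : (Fin 3 → ℝ) → ℝ), M.det ≠ 0 →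
      (∀ p : Fin 3 → ℝ, 0 < p 2 → 0 < c p ∧ 0 < g p 2 ∧ Ql (g p) = c p • M.mulVec (Ql p)) →
      (∀ p' : Fin 3 → ℝ, 0 < p' 2 → ∃ p : Fin 3 → ℝ, 0 < p 2 ∧ g p = p') →
      ∀ v : Fin 4 → Fin 4 → ℝ, g '' Spx v = Spx (fun i => M.mulVec (v i)))
    (J : (Fin 3 → ℝ) → (Fin 3 → ℝ))
    (hJ : ∀ p, J p = ![p 0 / (p 0 ^ 2 + p 1 ^ 2 + p 2 ^ 2), -p 1 / (p 0 ^ 2 + p 1 ^ 2 + p 2 ^ 2),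
      p 2 / (p 0 ^ 2 + p 1 ^ 2 + p 2 ^ 2)])
    (v : Fin 4 → Fin 4 → ℝ) :
    J '' Spx v = Spx (fun i => (!![0, 0, 0, 1; 0, 1, 0, 0; 0, 0, -1, 0; 1, 0, 0, 0] :
      Matrix (Fin 4) (Fin 4) ℝ).mulVec (v i)) := by
  refine hcov J _ (fun p => 1 / (p 0 ^ 2 + p 1 ^ 2 + p 2 ^ 2)) ?_ ?_ ?_ v
  · rw [Matrix.det_fin_four]
    simp
  · intro p hp
    have hn := inversion_normSq_pos hp
    refine ⟨by positivity, ?_, inversion_Ql Ql hQl J hJ hn.ne'⟩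
    simp only [hJ, Matrix.cons_val_two, Matrix.tail_cons, Matrix.head_cons]
    exact div_pos hp hn
  · intro p' hp'
    have hn := inversion_normSq_pos hp'
    refine ⟨J p', ?_, inversion_inversion J hJ hn.ne'⟩
    simp only [hJ, Matrix.cons_val_two, Matrix.tail_cons, Matrix.head_cons]
    exact div_pos hp' hn

/-- The inversion matrix on the lift of an ideal point `w`: `(1, Re w, -Im w, |w|²)`. [folklore] -/
theorem inversion_mulVec_lift (w : ℂ) :
    (!![0, 0, 0, 1; 0, 1, 0, 0; 0, 0, -1, 0; 1, 0, 0, 0] : Matrix (Fin 4) (Fin 4) ℝ).mulVec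
      ![Complex.normSq w, w.re, w.im, 1] = ![1, w.re, -w.im, Complex.normSq w] := by
  ext i
  fin_cases i <;> simp [Matrix.mulVec, dotProduct, Fin.sum_univ_four]

/-- For `w ≠ 0`, `(1, Re w, -Im w, |w|²) = |w|² · ℓ'(w⁻¹)`: the inversion is the Poincaré extension of
`w ↦ w⁻¹`. [folklore] -/
theorem lift_inv {w : ℂ} (hw : w ≠ 0) :
    (![1, w.re, -w.im, Complex.normSq w] : Fin 4 → ℝ) =
      Complex.normSq w • ![Complex.normSq w⁻¹, (w⁻¹).re, (w⁻¹).im, 1] := by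
  have hN : Complex.normSq w ≠ 0 := (Complex.normSq_pos.mpr hw).ne'
  ext i
  fin_cases i <;> simp [Complex.inv_re, Complex.inv_im] <;> field_simp

/-! ## Transport of the goal -/

/-- **Transport of the goal along a pair of mutually inverse moves** `Φ : σ → σ'`, `Ψ : σ' → σ` (registered
sub-goal `idealSpxAux_goal_transport`): existence on `σ'` is carried back by `Ψ`, and the class of a
representation on `σ` is read through `Φ` and congruence on `σ'`. [folklore] -/
theorem idealSpxAux_goal_transport :
    ∀ (ρ : ℂ → Literature.NumberTheory.Transcendental.KZ.IntegralRep 3) (Φ Ψ : (Fin 3 → ℝ) → (Fin 3 → ℝ)),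
    (∀ r : Literature.NumberTheory.Transcendental.KZ.IntegralRep 3, r.domain ⊆ {p | 0 < p 2} →
    Set.EqOn r.integrand (fun p => 1 / p 2 ^ 3) r.domain →
    ∀ r' : Literature.NumberTheory.Transcendental.KZ.IntegralRep 3, r'.domain = Φ '' r.domain →
    Set.EqOn r'.integrand (fun p => 1 / p 2 ^ 3) r'.domain →
    Literature.NumberTheory.Transcendental.KZ.Equivalent r r') →
    (∀ r : Literature.NumberTheory.Transcendental.KZ.IntegralRep 3, r.domain ⊆ {p | 0 < p 2} →
    Set.EqOn r.integrand (fun p => 1 / p 2 ^ 3) r.domain →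
    ∃ r₁ : Literature.NumberTheory.Transcendental.KZ.IntegralRep 3, r₁.domain = Ψ '' r.domain ∧
    Set.EqOn r₁.integrand (fun p => 1 / p 2 ^ 3) r₁.domain) → ∀ (σ σ' : Set (Fin 3 → ℝ)), σ ⊆ {p | 0 < p 2} →
    σ' ⊆ {p | 0 < p 2} → Φ '' σ = σ' → Ψ '' σ' = σ → (∃ R : Literature.NumberTheory.Transcendental.KZ.IntegralRep 3,
    R.domain = σ' ∧ Set.EqOn R.integrand (fun p => 1 / p 2 ^ 3) R.domain) →
    (∀ R : Literature.NumberTheory.Transcendental.KZ.IntegralRep 3, R.domain = σ' →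
    Set.EqOn R.integrand (fun p => 1 / p 2 ^ 3) R.domain → ∃ z : ℂ, IsAlgebraic ℚ z ∧ 0 < z.im ∧
    Literature.NumberTheory.Transcendental.KZ.of R - Literature.NumberTheory.Transcendental.KZ.of (ρ z) ∈ Literature.NumberTheory.Transcendental.KZ.relations) →
    (∃ R : Literature.NumberTheory.Transcendental.KZ.IntegralRep 3, R.domain = σ ∧
    Set.EqOn R.integrand (fun p => 1 / p 2 ^ 3) R.domain) ∧
    (∀ R : Literature.NumberTheory.Transcendental.KZ.IntegralRep 3, R.domain = σ →
    Set.EqOn R.integrand (fun p => 1 / p 2 ^ 3) R.domain → ∃ z : ℂ, IsAlgebraic ℚ z ∧ 0 < z.im ∧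
    Literature.NumberTheory.Transcendental.KZ.of R - Literature.NumberTheory.Transcendental.KZ.of (ρ z) ∈ Literature.NumberTheory.Transcendental.KZ.relations) := by
  intro ρ Φ Ψ hΦ hΨ σ σ' hσ hσ' h1 h2 hex hcl
  obtain ⟨R', hR'd, hR'i⟩ := hex
  constructor
  · obtain ⟨r₁, hr₁d, hr₁i⟩ := hΨ R' (hR'd ▸ hσ') hR'i
    exact ⟨r₁, by rw [hr₁d, hR'd, h2], hr₁i⟩
  · intro R hRd hRi
    have heq : KZ.Equivalent R R' := hΦ R (hRd ▸ hσ) hRi R' (by rw [hRd, h1, hR'd]) hR'i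
    obtain ⟨z, hz, hzi, hzR⟩ := hcl R' hR'd hR'i
    refine ⟨z, hz, hzi, ?_⟩
    have e : KZ.of R - KZ.of (ρ z) = (KZ.of R - KZ.of R') + (KZ.of R' - KZ.of (ρ z)) := by abel
    rw [e]
    exact add_mem heq hzR

end Summit.KontsevichZagierPeriods.HyperbolicBloch.OffTetraSectorKernel

end
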